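import Summits.CriticalPhenomena.PercolationContinuityZ3.Theorems.PercNearOneGluingNoHeavyQuantFarK5F41
import Summits.CriticalPhenomena.PercolationContinuityZ3.Theorems.PercNearOneGluingNoHeavyQuantFarK5F52
import Summits.CriticalPhenomena.PercolationContinuityZ3.Theorems.PercNearOneGluingNoHeavyQuantZeroOneK5
import HarnessLib

/-!
# THE FAR-RELAY ROW (`Quant.FarRelayRow`) HOLDS ON EVERY WEIGHTED GRAPH WITH AT MOST FIVE VERTICES

builds on p205010 (kernel theorem, internal audit signed; external expert review pending)

Support file (`--supports stmt-CriticalPhenomena-4575`), seat `prim-cert-1` (gen 9).  QUANT lane rung R8: `Quant.FarRelayRow` (OPEN in general;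
PROVED for stars / block-stars / independent legs, census-clean through `n = 8` exhaustive): for every finite weighted graph, `o`, `A`, layer `j`, `t`:
`2j < Σ_{a∈A} P(o ↔ a)` and `P(o ↮ a) ≤ t` (`a ∈ A`) imply `P(#{a ∈ A : o ↔ a} ≤ j) ≤ t`.

**`TwoCopy.farRelayRow_of_card_le_five`: FAR for every weighted graph on `n ≤ 5` vertices, every `A`, `o`, `j`, `t`.**  Case analysis
(`farp_of_card_le_five`): layer `0` and layer `1` with `o ∈ A` are elementary (`FARp.zero`, `FARp.one_of_mem`), `|A| ≤ 2j` is vacuous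
(`FARp.of_card_le`), which on five vertices leaves exactly three instances, each discharged by an exact two-copy (Bernstein bidegree-2)
certificate checked by `TwoCopy.twoCopyCheck` (COMPUTATIONAL files, `native_decide`):
* `|A| = 3`, `j = 1` (`Z(3,2)` = `OneCutFive.ZeroOneThree`): `TwoCopy.zeroOneThree_of_card_le_five` (`…QuantZeroOneK5`; `n ≤ 4` by
  `ThreePort.zeroOneThree_of_card_le_four`);
* `|A| = 4`, `j = 1`, `o ∉ A`: `TwoCopy.farp_four_one_fin5` (`…QuantFarK5F41`);
* `|A| = 5`, `j = 2` (`o ∈ A = univ`): `TwoCopy.farp_five_two_fin5` (`…QuantFarK5F52`).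
No sorries; axioms standard + the three `native_decide` certificate checks (`z5_check`, `f41_check`, `f52_check`).
[cite: KozmaNitzan2024, Lemma 2 (p. 6), Conjecture 3 (p. 15)] (context; FAR is this programme's statement).
-/

namespace Summit.CriticalPhenomena.PercolationContinuityZ3.Theorems.TwoCopy

open Finset MeasureTheory
open Literature.Probability.Percolation Literature.Probability.LatticeModels
open scoped Classical

variable {n : ℕ}

/-- FAR at layer `1` with three relays on `n ≤ 5` vertices is `Z(3,2)` (`zeroOneThree_of_card_le_five`). [this work] -/
theorem farp_three_one_of_card_le_five (hn : n ≤ 5) (w : Sym2 (Fin n) → unitInterval) (A : Finset (Fin n)) (o : Fin n)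
    (hA : A.card = 3) : FARp w A o 1 := by
  intro hEN t hcut
  exact zeroOneThree_of_card_le_five hn w A o t hA (by norm_num at hEN; exact hEN) hcut

/-- **Every FAR instance on at most five vertices.** [this work] -/
theorem farp_of_card_le_five (hn : n ≤ 5) (w : Sym2 (Fin n) → unitInterval) (A : Finset (Fin n)) (o : Fin n) (j : ℕ) :
    FARp w A o j := by
  have hAn : A.card ≤ n := by simpa using Finset.card_le_univ A
  rcases j with _ | j
  · exact FARp.zero w A o
  by_cases hAj : A.card ≤ 2 * (j + 1)
  · exact FARp.of_card_le w A o (j + 1) hAj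
  rw [not_le] at hAj
  rcases j with _ | j
  · -- layer 1: `|A| ∈ {3, 4, 5}`
    show FARp w A o 1
    by_cases hoA : o ∈ A
    · exact FARp.one_of_mem w A o hoA (by omega)
    have hAo : A.card + 1 ≤ n := by
      have h := Finset.card_le_univ (insert o A)
      rw [Finset.card_insert_of_notMem hoA, Fintype.card_fin] at h
      exact h
    rcases (show A.card = 3 ∨ A.card = 4 by omega) with h3 | h4
    · exact farp_three_one_of_card_le_five hn w A o h3
    · have hn5 : n = 5 := by omega
      subst hn5
      exact farp_four_one_fin5 w A o hoA h4
  · rcases j with _ | j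
    · -- layer 2: `|A| = 5 = n`, `o ∈ A = univ`
      show FARp w A o 2
      have hA5 : A.card = 5 := by omega
      have hn5 : n = 5 := by omega
      subst hn5
      exact farp_five_two_fin5 w A o hA5
    · exfalso
      omega

/-- **`Quant.FarRelayRow` restricted to at most five vertices** (its exact shape): for `n ≤ 5`, every weight vector `w`, vertex set `A`,
observer `o`, layer `j` and `t`, `2j < Σ_{a∈A} P(o ↔ a)` and `∀ a ∈ A, P(o ↮ a) ≤ t` imply `P(#{a ∈ A : o ↔ a} ≤ j) ≤ t`.
(Three two-copy certificates + elementary cases; see the module docstring.) [this work] -/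
theorem farRelayRow_of_card_le_five (hn : n ≤ 5) (w : Sym2 (Fin n) → unitInterval) (A : Finset (Fin n)) (o : Fin n) (j : ℕ)
    (t : ℝ) (hEN : (2 * j : ℝ) < ∑ a ∈ A, (prodBernoulli w).real (openConn o a))
    (hcut : ∀ a ∈ A, (prodBernoulli w).real (openConn o a)ᶜ ≤ t) :
    (prodBernoulli w).real {ω : BondConfig (Fin n) | (A.filter fun a => ω ∈ openConn o a).card ≤ j} ≤ t :=
  farp_of_card_le_five hn w A o j hEN t hcut

end Summit.CriticalPhenomena.PercolationContinuityZ3.Theorems.TwoCopy
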